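import Summits.ABC.IUTFork.Joshi.TestLicenceStatementSquare
import Summits.ABC.IUTFork.Cor312PinnedIdentified
import HarnessLib

/-!
# Test artefact (c9): with the PRINTED indeterminacies, the licence S forces `−|log(q)| = −|log(Θ)|` —
# S ⟹ Statement-as-typed WITH EQUALITY for every hull-generating q-datum over the frozen situation

AUTHORED BY abc-iut-E-cx (refuter seat, block-E adversary); proxy-filed VERBATIM by a prover seat (gate rule `theorems.refuter`).

Sequel to (c8) `TestLicenceStatementSquare` (p435470), proof-only, no new `def`. Over the frozen-print situation `naiveFull p`
(Ism = {±1} at the nonarchimedean place, abc-iut-w5-d247's contentful naive situation) and c312-3/w5-d247's pinned family of settings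
`withQDatum p qK hqK` — the q-DATUM `qK` being the only free parameter (any Kummer datum generating hull-sets) — the licence
S = `PilotKummerIndRelated` forces the q-regions on `𝔽_l^⋇` to be the Θ-regions `B_{j²}` (c312-1/w5-d230
`pilotKummerIndRelated_iff_generates_theta`), hence `−|log(q)| = −(5/2)·log p = −|log(Θ)|`:
* `withQDatum_negLogQ_eq_negLogTheta_of_pilotKummerIndRelated` — S ⟹ `−|log(q)| = −|log(Θ)|` (EQUALITY);
* `withQDatum_statement_of_pilotKummerIndRelated` — S ⟹ Cor. 3.12-as-typed (with equality), for EVERY such q-datum.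
So at Mochizuki's printed indeterminacies the licence can only ever yield the inequality of Cor. 3.12 in its degenerate, equality
form (the q-pilot region IS a Θ-translate); a strict inequality under S requires leaving the frozen instantiation (X-07′, R17 —
and there the Statement is undefined as typed, p431886). Generalises (c8)'s exponent-family implication S ⟹ St.

Interface/toy level. The campaign LOCATES; it takes no side on [IUTchIII] Cor. 3.12, on [Joshi2024ATS3], or on any author;
typed ≠ proved ≠ endorsed. References: [IUTchIII] Cor. 3.12 p. 174, Thm. 3.11, Rem. 3.12.2 (ii); [SS2018] §2.2 pp. 9–10.
-/

open Set

namespace Summit.ABC.IUTFork.Joshi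

open Thm311 Cor312 Cor312Vol Cor312.Checks Cor312.IdentifiedNonVacuity Literature.IUT.LogThetaLattice
open PinnedWitness NaiveWitness GluedMonoids.Naive

section Frozen

variable (p : ℕ) [hp : Fact p.Prime]
  (qK : ∀ v : toyIndex.V, v ∈ toyIndex.Vbad → Set (signShells.StarPacket v))
  (hqK : ∀ (j : toyIndex.Label) (vQ : toyIndex.VQ), ∃ k : ℤ, pBall p j vQ k = ballOfMonoid p qK j vQ)

/-- Under S the q-regions of `withQDatum p qK` on `𝔽_l^⋇` are those of the Θ-valued exponent setting `e = (1,4)` (both `B_{j²}`).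
[folklore] -/
theorem withQDatum_qRegion_eq_of_pilotKummerIndRelated
    (h : PilotKummerIndRelated (naiveFull p).toLatticeSituation (withQDatum p qK hqK) (ballOfMonoid p) qK)
    (i : Fin toyIndex.lstar) (vQ : toyIndex.VQ) :
    (withQDatum p qK hqK).qRegion (Setting.labelSucc i) vQ =
      (expSetting p expMochizuki).qRegion (Setting.labelSucc i) vQ := by
  have hgen : ∀ (j : toyIndex.Label) (vQ : toyIndex.VQ), ballOfMonoid p qK j vQ = pBall p j vQ (jsq j) :=
    (pilotKummerIndRelated_iff_generates_theta p qK hqK).mp h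
  rw [withQDatum_qRegion, hgen, expSetting_qRegion, expAt_of_ne_zero expMochizuki (Setting.labelSucc_ne_zero i)]
  congr 1

/-- **S ⟹ `−|log(q)| = −|log(Θ)|` (EQUALITY) at the printed indeterminacies**, for every hull-generating q-datum. [folklore] -/
theorem withQDatum_negLogQ_eq_negLogTheta_of_pilotKummerIndRelated
    (h : PilotKummerIndRelated (naiveFull p).toLatticeSituation (withQDatum p qK hqK) (ballOfMonoid p) qK) :
    (((withQDatum p qK hqK).negLogQ : ℝ) : WithTop ℝ) = (withQDatum p qK hqK).negLogTheta := by
  have hq : (withQDatum p qK hqK).negLogQ = (expSetting p expMochizuki).negLogQ :=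
    negLogQ_congr_labelSucc (expSetting p expMochizuki) (withQDatum p qK hqK) rfl
      (withQDatum_qRegion_eq_of_pilotKummerIndRelated p qK hqK h)
  have h5 : esum expMochizuki = 5 := by decide
  rw [hq, expSetting_negLogQ, withQDatum_negLogTheta, h5]
  push_cast
  ring_nf

/-- **S ⟹ Corollary 3.12-as-typed (with equality) at the printed indeterminacies, for EVERY hull-generating q-datum** over the
frozen situation `naiveFull p`. A strict inequality under S needs an instantiation outside the frozen one (X-07′, R17), where the
Statement is undefined as typed (p431886). [folklore] -/
theorem withQDatum_statement_of_pilotKummerIndRelated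
    (h : PilotKummerIndRelated (naiveFull p).toLatticeSituation (withQDatum p qK hqK) (ballOfMonoid p) qK) :
    (withQDatum p qK hqK).Statement :=
  ⟨by rw [withQDatum_negLogTheta]; exact WithTop.coe_ne_top,
    le_of_eq (withQDatum_negLogQ_eq_negLogTheta_of_pilotKummerIndRelated p qK hqK h)⟩

end Frozen

end Summit.ABC.IUTFork.Joshi
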